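import Literature.NumberTheory.EllipticCurves.HeegnerPointsLevelTransport
import HarnessLib

/-!
# Level transport at CM points of level `N` with `gcd(N, D) > 1`:
# the sandwich `Λ_{Nτ} = NΛ_τ + θ'Λ_τ` under `gcd(N, β, (β² − D)/4N) = 1`

Topic `NumberTheory/EllipticCurves` (complex multiplication), namespace
`Literature.NumberTheory.EllipticCurves`.  Theorems only (no definition, no named fact).

`HeegnerPointsLevelTransport.lean` proves, for a Heegner form `Q = (A, B, C)` of level `N` and
discriminant `D` with **`gcd(N, D) = 1`**, that an automorphism `σ` of `ℂ` fixing `√D` and `j(τ_Q)`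
transports the level-`N` structure `(Λ_{τ_Q}, Λ_{Nτ_Q})` to itself
(`levelTransport_self_of_apply_formJ_eq`).  The coprimality enters only through the Bezout identity
`uN + vβ = 1` in the sandwich `mem_iff_of_level_relations`.  For the CM points of level `N`
attached to *non-maximal orders* needed in Cox's proof of Thm. 12.2 — `τ₀/3` for the order of
conductor `3`, a root of `9x² + 3bx + c`, discriminant `9D` — one has `gcd(N, D') = gcd(9, 9D) ≠ 1`,
but still `gcd(N, β, c) = 1` with `c = (β² − D')/4N` (`= C` when `A = N`).  This file runs the
same engine under the weaker Bezout identity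

  `uN + vβ + wc = 1`,  `4Nc = β² − D`  (`θθ' = Nc` for `θ, θ' = (−β ± √D)/2`):

* `mem_iff_of_level_relations_bezout` — the sandwich `S_N = NS + θ'S` from the four
  `𝔫`-relations and `uN + vβ + wc = 1`, `θθ' = Nc` (for `z ∈ S_N`:
  `z = N(uz − vλ) + θ'(−vz + wλ)`, `θz = Nλ`);
* `mem_lattice_levelPoint_iff_bezout`, `mem_transport_levelPoint_iff_bezout`,
  `levelTransport_of_transport_lattice_eq_bezout` — the engine of the parent file verbatim under
  the new hypothesis;
* `levelTransport_self_of_apply_formJ_eq_bezout` — **`σ ∈ Aut(ℂ)` fixing `√D` and `j(τ_Q)`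
  transports the level-`N` structure of `τ_Q` to itself**, for `Q ∈ heegnerForms N D` (any
  `D < 0`), `B ≡ β (mod 2N)`, `4Nc = β² − D`, `gcd(N, β, c) = 1`;
* `levelTransport_self_of_apply_formJ_eq_of_fst_eq` — the case `A = N`, `gcd(N, C) = 1`
  (`β = B`, `c = C`), which covers the points `τ₀/3 ↔ (9, 3b, c)` and `τ₀/2 ↔ (4, 2b, c)` of
  Cox §12.

Gross 1984, §I.1 phrases Heegner points through `𝔫` with `𝒪/𝔫 ≅ ℤ/N`, a condition that makes
sense for any order `𝒪`; the sandwich is the identity `N𝔞𝔫⁻¹ = 𝔫̄𝔞`.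

## References

* B. H. Gross, *Heegner points on `X₀(N)`*, 1984, §I.1. [Gross1984]
* D. A. Cox, *Primes of the form x² + ny²*, 2nd ed., 2013, §12.A proof of Thm. 12.2
  (the point `τ₀/3` and the order `𝒪' = [1, 3τ₀]`), §7.B. [Cox2013]
* G. Shimura, *Introduction to the arithmetic theory of automorphic functions*, 1971, §6.8.
  [ShimuraIATAF1971]
-/

noncomputable section

open Complex UpperHalfPlane CongruenceSubgroup PeriodPair NumberField
open scoped MatrixGroups nonZeroDivisors

namespace Literature.NumberTheory.EllipticCurves

open Literature.NumberTheory.EllipticCurves.ModularForms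
  Literature.NumberTheory.QuadraticFields.BinaryQuadraticForm
  Literature.NumberTheory.QuadraticFields.Quadratic

/-! ### The sandwich under `uN + vβ + wc = 1`, `θθ' = Nc` -/

/-- **The level lattice is pinned down by the `𝔫`-relations** (Bezout form `uN + vβ + wc = 1`).
Let `S_N ⊆ S` be subgroups of `ℂ` with `NS ⊆ S_N`, `θS_N ⊆ NS`, `θ'S ⊆ S_N`, where `θ + θ' = −β`,
`θθ' = Nc` and `uN + vβ + wc = 1`.  Then `S_N = NS + θ'S`: for `z ∈ S_N` and `θz = Nλ` (`λ ∈ S`),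
`z = (uN + vβ + wc)z = N(uz − vλ) + θ'(−vz + wλ)`.  (Gross 1984, §I.1: `N𝔞𝔫⁻¹ = 𝔫̄𝔞`.)
[cite: Gross1984, §I.1] -/
theorem mem_iff_of_level_relations_bezout {S S_N : Submodule ℤ ℂ} {θ θ' : ℂ} {N : ℕ} {β c u v w : ℤ}
    (hN : (N : ℂ) ≠ 0) (hsum : θ + θ' = -β) (hprod : θ * θ' = N * c)
    (huvw : u * N + v * β + w * c = 1) (h1 : S_N ≤ S)
    (h2 : ∀ a ∈ S, (N : ℂ) * a ∈ S_N) (h3 : ∀ z ∈ S_N, (N : ℂ)⁻¹ * (θ * z) ∈ S)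
    (h4 : ∀ b ∈ S, θ' * b ∈ S_N) (x : ℂ) :
    x ∈ S_N ↔ ∃ a ∈ S, ∃ b ∈ S, x = N * a + θ' * b := by
  constructor
  · intro hx
    refine ⟨u * x - v * ((N : ℂ)⁻¹ * (θ * x)), ?_, -(v * x) + w * ((N : ℂ)⁻¹ * (θ * x)), ?_, ?_⟩
    · refine sub_mem ?_ ?_
      · rw [← zsmul_eq_mul]; exact S.smul_mem u (h1 hx)
      · rw [← zsmul_eq_mul]; exact S.smul_mem v (h3 x hx)
    · refine add_mem ?_ ?_
      · rw [← zsmul_eq_mul]; exact S.neg_mem (S.smul_mem v (h1 hx))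
      · rw [← zsmul_eq_mul]; exact S.smul_mem w (h3 x hx)
    · have huvwC : (u : ℂ) * N + v * β + w * c = 1 := by exact_mod_cast huvw
      have hθ' : θ' = -β - θ := by linear_combination hsum
      have hcancel : (N : ℂ) * ((v : ℂ) * ((N : ℂ)⁻¹ * (θ * x))) = v * (θ * x) := by
        field_simp
      have hcancel' : θ' * ((w : ℂ) * ((N : ℂ)⁻¹ * (θ * x))) = w * c * x := by
        rw [show θ' * ((w : ℂ) * ((N : ℂ)⁻¹ * (θ * x))) = w * ((N : ℂ)⁻¹ * (θ * θ')) * x by ring,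
          hprod, ← mul_assoc (N : ℂ)⁻¹, inv_mul_cancel₀ hN, one_mul]
      rw [mul_sub, hcancel, mul_add, hcancel', hθ']
      linear_combination (-x) * huvwC
  · rintro ⟨a, ha, b, hb, rfl⟩
    exact add_mem (h2 a ha) (h4 b hb)

/-- `θθ' = Nc` for `θ, θ' = (−β ± √D)/2` and `4Nc = β² − D`. [folklore] -/
theorem theta_mul_thetaBar {D β c : ℤ} {N : ℕ} (hD : D < 0) (hc : 4 * N * c = β ^ 2 - D) :
    (-β + sqrtDisc D) / 2 * ((-β - sqrtDisc D) / 2) = N * c := by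
  have hcC : 4 * (N : ℂ) * c = β ^ 2 - D := by exact_mod_cast hc
  have hs := sqrtDisc_sq hD
  linear_combination (-1 / 4 : ℂ) * hs - (1 / 4 : ℂ) * hcC

/-! ### The `𝔫`-relations engine under the Bezout hypothesis -/

section Engine

variable {N : ℕ} [NeZero N] {D β c u v w : ℤ} {σ : ℂ ≃+* ℂ} {Q Q' : ℤ × ℤ × ℤ}

/-- **`Λ_{Nτ} = NΛ_τ + θ'Λ_τ`** for a Heegner form of level `N`, discriminant `D < 0`,
`B ≡ β (mod 2N)`, `4Nc = β² − D` and `uN + vβ + wc = 1`. [cite: Gross1984, §I.1] -/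
theorem mem_lattice_levelPoint_iff_bezout (hQ : Q ∈ heegnerForms N D) (hD : D < 0)
    (hc : 4 * N * c = β ^ 2 - D) (huvw : u * N + v * β + w * c = 1)
    (hβ : Q.2.1 ≡ β [ZMOD 2 * N]) (x : ℂ) :
    x ∈ (ofUpperHalfPlane (levelPoint N (heegnerTau Q))).lattice ↔
      ∃ a ∈ (ofUpperHalfPlane (heegnerTau Q)).lattice, ∃ b ∈ (ofUpperHalfPlane (heegnerTau Q)).lattice,
        x = N * a + (-β - sqrtDisc D) / 2 * b := by
  have hN0 : (N : ℂ) ≠ 0 := by exact_mod_cast NeZero.ne N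
  exact mem_iff_of_level_relations_bezout hN0 (by ring) (theta_mul_thetaBar hD hc) huvw
    (lattice_levelPoint_le _) (natCast_mul_mem_lattice_levelPoint _)
    (inv_mul_theta_mul_mem_lattice hQ hD hβ) (thetaBar_mul_mem_lattice_levelPoint hQ hD hβ) x

/-- **Transported level lattice** (Bezout form): for `σ` fixing `√D`, the transports `M = Λ_τ^σ`,
`M_N = Λ_{Nτ}^σ` again satisfy `M_N = NM + θ'M`. [cite: Gross1984, §I.1] -/
theorem mem_transport_levelPoint_iff_bezout (hQ : Q ∈ heegnerForms N D) (hD : D < 0)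
    (hc : 4 * N * c = β ^ 2 - D) (huvw : u * N + v * β + w * c = 1)
    (hβ : Q.2.1 ≡ β [ZMOD 2 * N]) (hσ : σ (sqrtDisc D) = sqrtDisc D) {M M_N : PeriodPair}
    (hM : IsTransportedBy σ (ofUpperHalfPlane (heegnerTau Q)) M)
    (hMN : IsTransportedBy σ (ofUpperHalfPlane (levelPoint N (heegnerTau Q))) M_N) (x : ℂ) :
    x ∈ M_N.lattice ↔ ∃ a ∈ M.lattice, ∃ b ∈ M.lattice, x = N * a + (-β - sqrtDisc D) / 2 * b := by
  have hN0 : (N : ℂ) ≠ 0 := by exact_mod_cast NeZero.ne N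
  refine mem_iff_of_level_relations_bezout (θ := (-β + sqrtDisc D) / 2) hN0 (by ring)
    (theta_mul_thetaBar hD hc) huvw ?_ ?_ ?_ ?_ x
  · exact hMN.le hM (lattice_levelPoint_le _)
  · have h := hM.mul_mem hMN (natCast_mul_mem_lattice_levelPoint (N := N) (heegnerTau Q))
    rwa [map_natCast] at h
  · have h3 : ∀ l ∈ (ofUpperHalfPlane (levelPoint N (heegnerTau Q))).lattice,
        (-β + sqrtDisc D) / 2 * l ∈ ((ofUpperHalfPlane (heegnerTau Q)).mulLeft N hN0).lattice :=
      fun l hl ↦ mem_mulLeft_lattice.mpr (inv_mul_theta_mul_mem_lattice hQ hD hβ l hl)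
    have h := hMN.mul_mem (hM.mulLeft N hN0) h3
    intro z hz
    have hz' := h z hz
    rw [ringEquiv_apply_theta hσ, mem_mulLeft_lattice, map_natCast] at hz'
    exact hz'
  · have h := hM.mul_mem hMN (thetaBar_mul_mem_lattice_levelPoint hQ hD hβ)
    rwa [ringEquiv_apply_thetaBar hσ] at h

/-- **The engine** (Bezout form): if `Λ_{τ_Q}^σ` is homothetic to `Λ_{τ_{Q'}}` for Heegner forms
`Q, Q'` of level `N`, discriminant `D < 0` with `B ≡ B' ≡ β (mod 2N)`, `4Nc = β² − D`,
`uN + vβ + wc = 1`, and `σ` fixes `√D`, then `LevelTransport N σ τ_Q τ_{Q'}`. [cite: Gross1984, §I.1] -/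
theorem levelTransport_of_transport_lattice_eq_bezout (hD : D < 0)
    (hc : 4 * N * c = β ^ 2 - D) (huvw : u * N + v * β + w * c = 1)
    (hσ : σ (sqrtDisc D) = sqrtDisc D)
    (hQ : Q ∈ heegnerForms N D) (hβ : Q.2.1 ≡ β [ZMOD 2 * N])
    (hQ' : Q' ∈ heegnerForms N D) (hβ' : Q'.2.1 ≡ β [ZMOD 2 * N])
    {M : PeriodPair} (hM : IsTransportedBy σ (ofUpperHalfPlane (heegnerTau Q)) M)
    {c₀ : ℂ} (hc₀ : c₀ ≠ 0) (hMc : M.lattice = ((ofUpperHalfPlane (heegnerTau Q')).mulLeft c₀ hc₀).lattice) :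
    LevelTransport N σ (heegnerTau Q) (heegnerTau Q') := by
  obtain ⟨M_N, hMN⟩ := exists_isTransportedBy σ (ofUpperHalfPlane (levelPoint N (heegnerTau Q)))
  refine levelTransport_of_isTransportedBy hM hMN hc₀ hMc ?_
  ext x
  rw [mem_transport_levelPoint_iff_bezout hQ hD hc huvw hβ hσ hM hMN x,
    mem_mulLeft_iff_of_descr hc₀ hMc (mem_lattice_levelPoint_iff_bezout hQ' hD hc huvw hβ')]

/-- **`σ ∈ Aut(ℂ)` fixing `√D` and `j(τ_Q)` fixes the level-`N` structure of `τ_Q`** (Bezout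
form, any negative discriminant): for `Q ∈ heegnerForms N D`, `B ≡ β (mod 2N)`, `4Nc = β² − D`,
`uN + vβ + wc = 1`.  `Λ^σ` has `j`-invariant `σ(j(Λ)) = j(Λ)`, hence is homothetic to `Λ`
(Cox, Thm. 10.9), and the engine applies with `Q' = Q`.  This is the transport used at the point
`τ₀/3` of Cox's proof of Thm. 12.2. [cite: Cox2013, §12.A proof of Thm. 12.2] [cite: Gross1984, §I.1] -/
theorem levelTransport_self_of_apply_formJ_eq_bezout (hD : D < 0)
    (hc : 4 * N * c = β ^ 2 - D) (huvw : u * N + v * β + w * c = 1)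
    (hσ : σ (sqrtDisc D) = sqrtDisc D)
    (hQ : Q ∈ heegnerForms N D) (hβ : Q.2.1 ≡ β [ZMOD 2 * N]) (hj : σ (formJ Q) = formJ Q) :
    LevelTransport N σ (heegnerTau Q) (heegnerTau Q) := by
  obtain ⟨M, hM⟩ := exists_isTransportedBy σ (ofUpperHalfPlane (heegnerTau Q))
  have hjM : (ofUpperHalfPlane (heegnerTau Q)).j = M.j := by
    rw [hM.j_eq, ← formJ_def, hj, formJ_def]
  obtain ⟨c₀, hc₀, hMc⟩ := exists_lattice_eq_mulLeft_of_j_eq hjM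
  exact levelTransport_of_transport_lattice_eq_bezout hD hc huvw hσ hQ hβ hQ hβ hM hc₀ hMc

/-- **The case `A = N`, `gcd(N, C) = 1`**: for a positive definite primitive form `Q = (N, B, C)` of
discriminant `D` (so `Q ∈ heegnerForms N D`, `β = B`, `c = C`, `4NC = B² − D`) with `gcd(N, C) = 1`,
every automorphism of `ℂ` fixing `√D` and `j(τ_Q)` fixes the level-`N` structure of `τ_Q`.
Examples: `τ₀/3 ↔ (9, 3b, c)` (`3 ∤ c`) and `τ₀/2 ↔ (4, 2b, c)` (`2 ∤ c`) for
`τ₀ ↔ (1, b, c)`, the CM points of the orders of conductor `3` and `2` in Cox §12.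
[cite: Cox2013, §12.A proof of Thm. 12.2] -/
theorem levelTransport_self_of_apply_formJ_eq_of_fst_eq (hD : D < 0)
    (hQ : Q ∈ heegnerForms N D) (hA : Q.1 = N) (hcop : IsCoprime (N : ℤ) Q.2.2)
    (hσ : σ (sqrtDisc D) = sqrtDisc D) (hj : σ (formJ Q) = formJ Q) :
    LevelTransport N σ (heegnerTau Q) (heegnerTau Q) := by
  obtain ⟨u, w, huw⟩ := hcop
  have hdisc : Q.2.1 ^ 2 - 4 * Q.1 * Q.2.2 = D := hQ.1
  have hc : 4 * N * Q.2.2 = Q.2.1 ^ 2 - D := by rw [← hdisc, hA]; ring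
  have huvw : u * N + 0 * Q.2.1 + w * Q.2.2 = 1 := by linear_combination huw
  exact levelTransport_self_of_apply_formJ_eq_bezout hD hc huvw hσ hQ (Int.ModEq.refl _) hj

end Engine

end Literature.NumberTheory.EllipticCurves

end
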